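import Mathlib
import Summits.KontsevichZagierPeriods.Zeta5Search.WedgeDictionaryOneTopKernel
import Summits.KontsevichZagierPeriods.Zeta5Search.EulerKernelBasisIntegrals
import Summits.KontsevichZagierPeriods.Zeta5Search.EulerKernelTornheim
import Summits.KontsevichZagierPeriods.Zeta5Search.EulerKernelLogMoments
import HarnessLib

/-!
# Brown–Zudilin's base value `I₀ = I(0,…,0) = 2ζ(5) + 4ζ(3)ζ(2)`, I: the one-variable steps
# (cell `pub-zeta5`, seat ct-1 g21; the `n = 0` clause of the named fact `I_init` [BrownZudilin2022, Sect. 2 (5)])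

HONEST FRAMING: systematic search; no irrationality claim unless certified.  Elementary real analysis: the one-variable
integrals of an evaluation of Brown–Zudilin's 5-fold cellular integral (1) at `a = 0`,
`∫ dt/((t₃−t₁)t₃(1−t₄)(t₄−t₂)(t₅−t₂)) = 2ζ(5) + 4ζ(3)ζ(2)` (their `I₀`, the coefficient of `Q_n` in (5); the source obtains
it with HyperInt), along the same route as the one-top datum (`WedgeDictionaryOneTopKernel` / `…Steps` / `…Value`):
`t₁`: `∫₀^b ds/(c−s) = log(c/(c−b))`; `t₅`: `∫_a^1 ds/(s−b) = log((1−b)/(a−b))`; `t₃`: `∫_b^a log(s/(s−b))/s ds = π²/6 − Li₂(b/a)`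
(primitive `−Li₂(b/s)`); `t₄` (after `t₂ = t₄y`): `∫₀¹ log((1−ty)/(t(1−y)))/(1−t) dt = π²/6 + Li₂(y) + ½log²(1−y)`
(primitive `Li₂(−y(1−t)/(1−y)) − Li₂(1−t)`, then Landen `reDilog_landen`); and the last integration
`∫₀¹ (π²/6 − Li₂ y)(π²/6 + Li₂ y + ½log²(1−y))/(1−y) dy = 2ζ(5) + 4ζ(3)ζ(2)` — at `y = 1−u` the integrand is
`E(π²/3 − E + ℓ²/2)/u` (`E = Li₂(u) + log u·log(1−u)` by Euler's reflection), i.e. `2ζ(2)·B3 − B7 + ½·B10 =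
4ζ(2)ζ(3) − 2ζ(5) + 4ζ(5)` in the basis of `EulerKernelBasisIntegrals` / `EulerKernelTornheim`.  Every step through
`WedgeDictionaryOneTop.ftc_open`; all integrands non-negative.  Theorems only, no notation, no definition; `ζ(5)` is the
value of a convergent integral — nothing about its irrationality.
-/

noncomputable section

open MeasureTheory Set Filter Topology intervalIntegral
open scoped ENNReal

namespace Summit.KontsevichZagierPeriods.Zeta5Search.CellularZetaFiveZero

open Literature.Analysis.SpecialFunctions (reDilog reDilog_zero reDilog_one continuous_reDilog hasDerivAt_reDilog)
open Literature.NumberTheory.Transcendental (zetaValue)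
open Summit.KontsevichZagierPeriods.Zeta5Search.WedgeDictionaryOneTop (ftc_open reDilog_landen)
open Summit.KontsevichZagierPeriods.Zeta5Search.EulerKernel

/-! ## 1. The `t₁`- and `t₅`-steps: `∫₀^b ds/(c−s) = log(c/(c−b))`, `∫_a^1 ds/(s−b) = log((1−b)/(a−b))` -/

/-- `∫_{(0,b)} ds/(c−s) = log(c/(c−b))` for `0 < b < c`, with integrability. [folklore] -/
theorem integral_inv_sub {b c : ℝ} (hb : 0 < b) (hbc : b < c) :
    IntegrableOn (fun s : ℝ => 1 / (c - s)) (Ioo 0 b) ∧ ∫ s in Ioo 0 b, 1 / (c - s) = Real.log (c / (c - b)) := by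
  have key := ftc_open (F := fun s : ℝ => -Real.log (c - s)) (f := fun s : ℝ => 1 / (c - s))
    (Fa := -Real.log (c - 0)) (Fb := -Real.log (c - b)) hb ?_ ?_ ?_ ?_
  · refine ⟨key.1, ?_⟩
    rw [key.2, sub_zero, Real.log_div (by linarith) (by linarith)]; ring
  · intro s hs
    have hcs : c - s ≠ 0 := by linarith [hs.2]
    exact (((hasDerivAt_id' s).const_sub c).log hcs).neg.congr_deriv (by field_simp)
  · intro s hs
    have : 0 < c - s := by linarith [hs.2]
    positivity
  · have h1 : c - 0 ≠ 0 := by linarith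
    exact ((by fun_prop (disch := assumption)) : ContinuousAt (fun s : ℝ => -Real.log (c - s)) 0)
      |>.tendsto.mono_left nhdsWithin_le_nhds
  · have h1 : c - b ≠ 0 := by linarith
    exact ((by fun_prop (disch := assumption)) : ContinuousAt (fun s : ℝ => -Real.log (c - s)) b)
      |>.tendsto.mono_left nhdsWithin_le_nhds

/-- `log(c/(c−b)) ≥ 0` for `0 < b < c`. [folklore] -/
theorem log_div_sub_nonneg {b c : ℝ} (hb : 0 < b) (hbc : b < c) : 0 ≤ Real.log (c / (c - b)) :=
  Real.log_nonneg ((one_le_div (by linarith)).2 (by linarith))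

/-- `ℝ≥0∞` form of the `t₁`-step with a constant `K ≥ 0`. [folklore] -/
theorem lintegral_inv_sub {b c K : ℝ} (hb : 0 < b) (hbc : b < c) (hK : 0 ≤ K) :
    ∫⁻ s in Ioo 0 b, ENNReal.ofReal (K * (1 / (c - s))) = ENNReal.ofReal (K * Real.log (c / (c - b))) := by
  obtain ⟨hI, hv⟩ := integral_inv_sub hb hbc
  have hnn : 0 ≤ᵐ[volume.restrict (Ioo 0 b)] fun s => K * (1 / (c - s)) :=
    (ae_restrict_mem measurableSet_Ioo).mono fun s hs => by
      have : 0 < c - s := by linarith [hs.2]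
      positivity
  rw [← ofReal_integral_eq_lintegral_ofReal (hI.const_mul K) hnn, MeasureTheory.integral_const_mul, hv]

/-- `∫_{(a,1)} ds/(s−b) = log((1−b)/(a−b))` for `b < a < 1`, with integrability. [folklore] -/
theorem integral_inv_sub' {a b : ℝ} (hba : b < a) (ha1 : a < 1) :
    IntegrableOn (fun s : ℝ => 1 / (s - b)) (Ioo a 1) ∧ ∫ s in Ioo a 1, 1 / (s - b) = Real.log ((1 - b) / (a - b)) := by
  have key := ftc_open (F := fun s : ℝ => Real.log (s - b)) (f := fun s : ℝ => 1 / (s - b))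
    (Fa := Real.log (a - b)) (Fb := Real.log (1 - b)) ha1 ?_ ?_ ?_ ?_
  · refine ⟨key.1, ?_⟩
    rw [key.2, Real.log_div (by linarith) (by linarith)]
  · intro s hs
    have hsb : s - b ≠ 0 := by linarith [hs.1]
    exact (((hasDerivAt_id' s).sub_const b).log hsb).congr_deriv (by field_simp)
  · intro s hs
    have : 0 < s - b := by linarith [hs.1]
    positivity
  · have h1 : a - b ≠ 0 := by linarith
    exact ((by fun_prop (disch := assumption)) : ContinuousAt (fun s : ℝ => Real.log (s - b)) a)
      |>.tendsto.mono_left nhdsWithin_le_nhds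
  · have h1 : (1:ℝ) - b ≠ 0 := by linarith
    exact ((by fun_prop (disch := assumption)) : ContinuousAt (fun s : ℝ => Real.log (s - b)) 1)
      |>.tendsto.mono_left nhdsWithin_le_nhds

/-- `log((1−b)/(a−b)) ≥ 0` for `b < a < 1`. [folklore] -/
theorem log_div_sub_nonneg' {a b : ℝ} (hba : b < a) (ha1 : a < 1) : 0 ≤ Real.log ((1 - b) / (a - b)) :=
  Real.log_nonneg ((one_le_div (by linarith)).2 (by linarith))

/-- `ℝ≥0∞` form of the `t₅`-step with a constant `K ≥ 0`. [folklore] -/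
theorem lintegral_inv_sub' {a b K : ℝ} (hba : b < a) (ha1 : a < 1) (hK : 0 ≤ K) :
    ∫⁻ s in Ioo a 1, ENNReal.ofReal (K * (1 / (s - b))) = ENNReal.ofReal (K * Real.log ((1 - b) / (a - b))) := by
  obtain ⟨hI, hv⟩ := integral_inv_sub' hba ha1
  have hnn : 0 ≤ᵐ[volume.restrict (Ioo a 1)] fun s => K * (1 / (s - b)) :=
    (ae_restrict_mem measurableSet_Ioo).mono fun s hs => by
      have : 0 < s - b := by linarith [hs.1]
      positivity
  rw [← ofReal_integral_eq_lintegral_ofReal (hI.const_mul K) hnn, MeasureTheory.integral_const_mul, hv]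

/-! ## 2. The `t₃`-step: `∫_b^a log(s/(s−b))/s ds = π²/6 − Li₂(b/a)` (`0 < b < a`) -/

/-- The `t₃`-integral: primitive `−Li₂(b/s)`, limit `−Li₂(1) = −π²/6` at `s = b⁺`. [folklore] -/
theorem integral_log_div {a b : ℝ} (hb : 0 < b) (hba : b < a) :
    IntegrableOn (fun s : ℝ => Real.log (s / (s - b)) / s) (Ioo b a) ∧
      ∫ s in Ioo b a, Real.log (s / (s - b)) / s = Real.pi ^ 2 / 6 - reDilog (b / a) := by
  have ha : 0 < a := hb.trans hba
  have key := ftc_open (F := fun s : ℝ => -reDilog (b / s)) (f := fun s : ℝ => Real.log (s / (s - b)) / s)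
    (Fa := -reDilog 1) (Fb := -reDilog (b / a)) hba ?_ ?_ ?_ ?_
  · refine ⟨key.1, ?_⟩
    rw [key.2, reDilog_one]; ring
  · intro s hs
    have hs0 : 0 < s := hb.trans hs.1
    have hs' : s ≠ 0 := hs0.ne'
    have hsb : s - b ≠ 0 := by linarith [hs.1]
    have hx0 : b / s ≠ 0 := div_ne_zero hb.ne' hs'
    have hx1 : b / s ≠ 1 := by intro h; rw [div_eq_one_iff_eq hs'] at h; linarith [hs.1]
    have hin : HasDerivAt (fun s : ℝ => b / s) (-b / s ^ 2) s := by
      exact ((hasDerivAt_const s b).div (hasDerivAt_id' s) hs').congr_deriv (by field_simp; ring)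
    have h := ((hasDerivAt_reDilog hx0 hx1).comp s hin).neg
    have hlog : Real.log (1 - b / s) = -Real.log (s / (s - b)) := by
      rw [show 1 - b / s = (s - b) / s by field_simp, Real.log_div hsb hs', Real.log_div hs' hsb]; ring
    rw [hlog] at h
    refine h.congr_deriv ?_
    field_simp
  · intro s hs
    have hs0 : 0 < s := hb.trans hs.1
    exact div_nonneg (Real.log_nonneg ((one_le_div (by linarith [hs.1])).2 (by linarith))) hs0.le
  · have hc : Continuous reDilog := continuous_reDilog
    have hb' : b ≠ 0 := hb.ne'
    have h : ContinuousAt (fun s : ℝ => -reDilog (b / s)) b := by fun_prop (disch := assumption)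
    have := h.tendsto
    rw [div_self hb'] at this
    exact this.mono_left nhdsWithin_le_nhds
  · have hc : Continuous reDilog := continuous_reDilog
    have ha' : a ≠ 0 := ha.ne'
    have h : ContinuousAt (fun s : ℝ => -reDilog (b / s)) a := by fun_prop (disch := assumption)
    exact h.tendsto.mono_left nhdsWithin_le_nhds

/-- `π²/6 − Li₂(b/a) ≥ 0` for `0 < b < a`. [folklore] -/
theorem dilog_defect_nonneg {a b : ℝ} (hb : 0 < b) (hba : b < a) : 0 ≤ Real.pi ^ 2 / 6 - reDilog (b / a) := by
  rw [← (integral_log_div hb hba).2]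
  refine setIntegral_nonneg measurableSet_Ioo fun s hs => ?_
  have hs0 : 0 < s := hb.trans hs.1
  exact div_nonneg (Real.log_nonneg ((one_le_div (by linarith [hs.1])).2 (by linarith))) hs0.le

/-- `ℝ≥0∞` form of the `t₃`-step with a constant `K ≥ 0`. [folklore] -/
theorem lintegral_log_div {a b K : ℝ} (hb : 0 < b) (hba : b < a) (hK : 0 ≤ K) :
    ∫⁻ s in Ioo b a, ENNReal.ofReal (K * (Real.log (s / (s - b)) / s)) =
      ENNReal.ofReal (K * (Real.pi ^ 2 / 6 - reDilog (b / a))) := by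
  obtain ⟨hI, hv⟩ := integral_log_div hb hba
  have hnn : 0 ≤ᵐ[volume.restrict (Ioo b a)] fun s => K * (Real.log (s / (s - b)) / s) :=
    (ae_restrict_mem measurableSet_Ioo).mono fun s hs => by
      have hs0 : 0 < s := hb.trans hs.1
      exact mul_nonneg hK (div_nonneg (Real.log_nonneg ((one_le_div (by linarith [hs.1])).2 (by linarith))) hs0.le)
  rw [← ofReal_integral_eq_lintegral_ofReal (hI.const_mul K) hnn, MeasureTheory.integral_const_mul, hv]

/-! ## 3. The `t₄`-step: `∫₀¹ log((1−ty)/(t(1−y)))/(1−t) dt = π²/6 + Li₂(y) + ½log²(1−y)` (`0 < y < 1`) -/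

/-- The `t₄`-integrand is non-negative on `(0,1)²`. [folklore] -/
theorem N_integrand_nonneg {y t : ℝ} (hy1 : y < 1) (ht0 : 0 < t) (ht1 : t < 1) :
    0 ≤ Real.log ((1 - t * y) / (t * (1 - y))) / (1 - t) := by
  refine div_nonneg (Real.log_nonneg ?_) (by linarith)
  rw [le_div_iff₀ (by nlinarith)]
  nlinarith

/-- The `t₄`-kernel of the base value: primitive `Li₂(−y(1−t)/(1−y)) − Li₂(1−t)`, continuous at both ends; then
Landen. [folklore] -/
theorem integral_N {y : ℝ} (hy0 : 0 < y) (hy1 : y < 1) :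
    IntegrableOn (fun t : ℝ => Real.log ((1 - t * y) / (t * (1 - y))) / (1 - t)) (Ioo 0 1) ∧
      ∫ t in Ioo (0:ℝ) 1, Real.log ((1 - t * y) / (t * (1 - y))) / (1 - t) =
        Real.pi ^ 2 / 6 + reDilog y + Real.log (1 - y) ^ 2 / 2 := by
  have hy1' : 1 - y ≠ 0 := by intro h; linarith
  have hc : Continuous reDilog := continuous_reDilog
  have key := ftc_open (F := fun t : ℝ => reDilog (-(y * (1 - t) / (1 - y))) - reDilog (1 - t))
    (f := fun t : ℝ => Real.log ((1 - t * y) / (t * (1 - y))) / (1 - t))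
    (Fa := reDilog (-(y * (1 - 0) / (1 - y))) - reDilog (1 - 0)) (Fb := reDilog (-(y * (1 - 1) / (1 - y))) - reDilog (1 - 1))
    zero_lt_one ?_ (fun t ht => N_integrand_nonneg hy1 ht.1 ht.2) ?_ ?_
  · refine ⟨key.1, ?_⟩
    rw [key.2]
    simp only [sub_self, mul_zero, zero_div, neg_zero, reDilog_zero, sub_zero, mul_one, zero_sub]
    rw [reDilog_landen hy0 hy1, reDilog_one]
    ring
  · intro t ht
    have ht0 : t ≠ 0 := ht.1.ne'
    have ht1' : 1 - t ≠ 0 := by linarith [ht.2]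
    have hty : 1 - t * y ≠ 0 := by nlinarith [ht.2]
    have hz : 0 < y * (1 - t) / (1 - y) := by
      have : 0 < 1 - t := by linarith [ht.2]
      have : 0 < 1 - y := by linarith
      positivity
    have hD1 : HasDerivAt (fun t : ℝ => reDilog (-(y * (1 - t) / (1 - y))))
        (Real.log ((1 - t * y) / (1 - y)) / (1 - t)) t := by
      have hin : HasDerivAt (fun t : ℝ => -(y * (1 - t) / (1 - y))) (y / (1 - y)) t :=
        ((((hasDerivAt_id' t).const_sub 1).const_mul y).div_const (1 - y)).neg.congr_deriv (by ring)
      have h := (hasDerivAt_reDilog (by linarith) (by linarith)).comp t hin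
      have hlog : Real.log (1 - -(y * (1 - t) / (1 - y))) = Real.log ((1 - t * y) / (1 - y)) := by
        congr 1; field_simp; ring
      rw [hlog] at h
      exact h.congr_deriv (by field_simp)
    have hD2 : HasDerivAt (fun t : ℝ => reDilog (1 - t)) (Real.log t / (1 - t)) t := by
      have h := (hasDerivAt_reDilog ht1' (by intro h; apply ht0; linarith)).comp t ((hasDerivAt_id' t).const_sub 1)
      refine h.congr_deriv ?_
      rw [sub_sub_cancel]; ring
    refine (hD1.sub hD2).congr_deriv ?_
    rw [show (1 - t * y) / (t * (1 - y)) = ((1 - t * y) / (1 - y)) / t by field_simp,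
      Real.log_div (div_ne_zero hty hy1') ht0]
    ring
  · exact ((by fun_prop : ContinuousAt (fun t : ℝ => reDilog (-(y * (1 - t) / (1 - y))) - reDilog (1 - t)) 0)
      |>.tendsto.mono_left nhdsWithin_le_nhds)
  · exact ((by fun_prop : ContinuousAt (fun t : ℝ => reDilog (-(y * (1 - t) / (1 - y))) - reDilog (1 - t)) 1)
      |>.tendsto.mono_left nhdsWithin_le_nhds)

/-- `N(y) ≥ 0`. [folklore] -/
theorem N_nonneg {y : ℝ} (hy0 : 0 < y) (hy1 : y < 1) : 0 ≤ Real.pi ^ 2 / 6 + reDilog y + Real.log (1 - y) ^ 2 / 2 := by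
  rw [← (integral_N hy0 hy1).2]
  exact setIntegral_nonneg measurableSet_Ioo fun t ht => N_integrand_nonneg hy1 ht.1 ht.2

/-- `ℝ≥0∞` form of the `t₄`-step with a constant `c ≥ 0`. [folklore] -/
theorem lintegral_N {y c : ℝ} (hy0 : 0 < y) (hy1 : y < 1) (hc : 0 ≤ c) :
    ∫⁻ t in Ioo (0:ℝ) 1, ENNReal.ofReal (c * (Real.log ((1 - t * y) / (t * (1 - y))) / (1 - t))) =
      ENNReal.ofReal (c * (Real.pi ^ 2 / 6 + reDilog y + Real.log (1 - y) ^ 2 / 2)) := by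
  obtain ⟨hI, hv⟩ := integral_N hy0 hy1
  have hnn : 0 ≤ᵐ[volume.restrict (Ioo (0:ℝ) 1)] fun t => c * (Real.log ((1 - t * y) / (t * (1 - y))) / (1 - t)) :=
    (ae_restrict_mem measurableSet_Ioo).mono fun t ht => mul_nonneg hc (N_integrand_nonneg hy1 ht.1 ht.2)
  rw [← ofReal_integral_eq_lintegral_ofReal (hI.const_mul c) hnn, MeasureTheory.integral_const_mul, hv]

/-! ## 4. The last integration: `∫₀¹ (π²/6 − Li₂(y))(π²/6 + Li₂(y) + ½log²(1−y))/(1−y) dy = 2ζ(5) + 4ζ(3)ζ(2)` -/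

/-- The weight `(π²/6 − Li₂(y))/(1−y)` is `≥ 0` on `(0,1)`. [folklore] -/
theorem weight_nonneg {y : ℝ} (hy0 : 0 < y) (hy1 : y < 1) : 0 ≤ (Real.pi ^ 2 / 6 - reDilog y) / (1 - y) := by
  have h := dilog_defect_nonneg hy0 hy1
  rw [div_one] at h
  exact div_nonneg h (by linarith)

/-- **The last integration of the base value**: with `E(u) = Li₂(u) + log u·log(1−u) = π²/6 − Li₂(1−u)` the integrand at
`y = 1−u` is `E(π²/3 − E + ℓ²/2)/u = 2ζ(2)·(E/u) − E²/u + ½ℓ²E/u`, so the value is `2ζ(2)·B3 − B7 + ½B10 =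
4ζ(2)ζ(3) − 2ζ(5) + 4ζ(5)`. [folklore] -/
theorem integral_last :
    IntegrableOn (fun y : ℝ => (Real.pi ^ 2 / 6 - reDilog y) / (1 - y) *
        (Real.pi ^ 2 / 6 + reDilog y + Real.log (1 - y) ^ 2 / 2)) (Ioo 0 1) ∧
      ∫ y in Ioo (0:ℝ) 1, (Real.pi ^ 2 / 6 - reDilog y) / (1 - y) * (Real.pi ^ 2 / 6 + reDilog y + Real.log (1 - y) ^ 2 / 2)
        = 2 * zetaValue 5 + 4 * zetaValue 3 * zetaValue 2 := by
  have P3 := pair_smul (1/2 : ℝ) integral_negLog_sq_mul_Ek_div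
  have P2 := pair_add (pair_smul (-1 : ℝ) integral_Ek_sq_div) P3
  have P1 := pair_add (pair_smul (2 * (Real.pi ^ 2 / 6) : ℝ) integral_Ek_div) P2
  have Q := pair_congr measurableSet_Ioo P1 (g := fun u : ℝ => (fun y : ℝ => (Real.pi ^ 2 / 6 - reDilog y) / (1 - y) *
        (Real.pi ^ 2 / 6 + reDilog y + Real.log (1 - y) ^ 2 / 2)) (1 - u)) (by
    intro u hu
    have hu0 : u ≠ 0 := hu.1.ne'
    have hrefl : reDilog (1 - u) = Real.pi ^ 2 / 6 - Real.log u * Real.log (1 - u) - reDilog u := by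
      rw [Literature.Analysis.SpecialFunctions.reDilog_reflection (x := 1 - u) (by linarith [hu.2]) (by linarith [hu.1]),
        sub_sub_cancel]; ring
    simp only [sub_sub_cancel, hrefl]
    generalize reDilog u = R
    generalize Real.log u = A
    generalize Real.log (1 - u) = B
    field_simp
    ring)
  have hI : IntegrableOn (fun y : ℝ => (Real.pi ^ 2 / 6 - reDilog y) / (1 - y) *
      (Real.pi ^ 2 / 6 + reDilog y + Real.log (1 - y) ^ 2 / 2)) (Ioo 0 1) := by
    have h1 := (intervalIntegrable_iff_integrableOn_Ioo_of_le zero_le_one).2 Q.1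
    have h2 := (h1.comp_sub_left 1).symm
    simp only [sub_sub_cancel, sub_self, sub_zero] at h2
    exact (intervalIntegrable_iff_integrableOn_Ioo_of_le zero_le_one).1 h2
  refine ⟨hI, ?_⟩
  have hcomp : ∫ y in Ioo (0:ℝ) 1, (Real.pi ^ 2 / 6 - reDilog y) / (1 - y) *
        (Real.pi ^ 2 / 6 + reDilog y + Real.log (1 - y) ^ 2 / 2)
      = ∫ u in Ioo (0:ℝ) 1, (fun y : ℝ => (Real.pi ^ 2 / 6 - reDilog y) / (1 - y) *
        (Real.pi ^ 2 / 6 + reDilog y + Real.log (1 - y) ^ 2 / 2)) (1 - u) := by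
    rw [← integral_Ioc_eq_integral_Ioo, ← intervalIntegral.integral_of_le zero_le_one,
      ← integral_Ioc_eq_integral_Ioo, ← intervalIntegral.integral_of_le zero_le_one]
    have h := intervalIntegral.integral_comp_sub_left (fun y : ℝ => (Real.pi ^ 2 / 6 - reDilog y) / (1 - y) *
        (Real.pi ^ 2 / 6 + reDilog y + Real.log (1 - y) ^ 2 / 2)) (1:ℝ) (a := 0) (b := 1)
    simp only [sub_self, sub_zero] at h
    exact h.symm
  rw [hcomp, Q.2, show zetaValue 2 = Real.pi ^ 2 / 6 from hasSum_zeta_two.tsum_eq]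
  ring

end Summit.KontsevichZagierPeriods.Zeta5Search.CellularZetaFiveZero
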